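import Summits.CriticalPhenomena.PercolationContinuityZ3.Theorems.PercNearOneGluingNoHeavyLowerTailThreePartitionTwistedUniv
import HarnessLib

/-!
# The TYPED SLICE of the twisted three-partition functional at a coordinate, I: types and the pinned typed sum
# (unit `prim-master-conj`, gen 34; `--supports stmt-CriticalPhenomena-4575`)

Framework for the "type-space" certificates of `run/shared/lean/prim/prim-l12/prim-master-conj/POINTWISE.md` §34–35
(THEOREM 1N and its relatives; memo `run/shared/lean/prim/prim-l12/FROM-prim-master-conj-g33-ONE-NESTED-STEP.md`).
Everything lives on ONE finite ground set `ι` with a distinguished coordinate `e` and a twist `τ ⊆ ι`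
(`…ThreePartitionADTwisted`: copies `S_a ∆ τ` of an ordered 3-partition `(S₁,S₂,S₃)`); sections are never materialised on
`ι ∖ e` — they are READ OFF through types.

* `tyAt 𝒳 e w ∈ Fin 3` — the TYPE of a set `w` at `e` for a family `𝒳`: `2` if `w ∖ e ∈ 𝒳` (deletion section), `1` if only
  `w ∪ e ∈ 𝒳` (contraction section), `0` otherwise; it ignores whether `e ∈ w` (`tyAt_congr`).  For an up-set the membership
  of `w` itself is read from its type and the bit `[e ∈ w]` (`mem_iff_rd`).  `typ 𝒰 𝒱 𝒲 e w : Ty = Fin 3 × Fin 3 × Fin 3`.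
* `tsumP 𝒰 𝒱 𝒲 e τ f` — the PINNED TYPED SUM `Σ f (typ a) (typ b) (typ c)` over ordered 3-partitions with `e` in the SECOND
  part (copies `a, b, c`): linear in `f` (`tsumP_add/sub/const_mul/listSum`), invariant under the permutations of the three
  arguments (`tsumP_swap13`; `tsumP_swap12` moves `e` back into part 2 — the types ignore `e`), hence
  `6 · tsumP f = tsumP (sym6 f)` and `tsumP f ≥ 0` as soon as the six-fold symmetrisation of `f` is nonnegative on the
  realised types (`tsumP_nonneg_of_sym6`); a pinned COUNT with a predicate on the three types is the pinned sum of its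
  indicator (`tri_pin_eq_tsumP`).
The slicing theorem, the typed Kleitman atoms and the certificate checker are in the companion `…TypedSliceKernel`;
THEOREM 1N in `…ThreePartitionOneNested`.  Pure bookkeeping, no `sorry`, standard axioms.  HONEST LABEL: a framework — it proves
nothing about the crux by itself. [this work]
-/

noncomputable section

open Finset
open scoped symmDiff Classical

namespace Summit.CriticalPhenomena.PercolationContinuityZ3.Theorems.ThreePartition

namespace TypedSlice

variable {ι : Type*}

/-! ## Types of a set at a coordinate -/

/-- The type space of one copy: levels in the three section pairs `U_i⁰ ⊆ U_i¹`. [this work] -/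
abbrev Ty : Type := Fin 3 × Fin 3 × Fin 3

/-- The type of `w` at `e` for the family `𝒳`: `2` if `w ∖ e ∈ 𝒳`, else `1` if `w ∪ e ∈ 𝒳`, else `0`. [this work] -/
def tyAt (𝒳 : Set (Set ι)) (e : ι) (w : Set ι) : Fin 3 :=
  if w \ {e} ∈ 𝒳 then 2 else if insert e w ∈ 𝒳 then 1 else 0

/-- The type triple of `w` at `e` for `(𝒰, 𝒱, 𝒲)`. [this work] -/
def typ (𝒰 𝒱 𝒲 : Set (Set ι)) (e : ι) (w : Set ι) : Ty := (tyAt 𝒰 e w, tyAt 𝒱 e w, tyAt 𝒲 e w)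

/-- `tyAt = 2` iff the deletion section is hit. [this work] -/
theorem tyAt_eq_two_iff (𝒳 : Set (Set ι)) (e : ι) (w : Set ι) : tyAt 𝒳 e w = 2 ↔ w \ {e} ∈ 𝒳 := by
  unfold tyAt
  split_ifs with h1 h2
  · exact ⟨fun _ => h1, fun _ => rfl⟩
  · exact ⟨fun h => absurd h (by decide), fun h => absurd h h1⟩
  · exact ⟨fun h => absurd h (by decide), fun h => absurd h h1⟩

/-- For an up-set, `1 ≤ tyAt` iff the contraction section is hit. [this work] -/
theorem one_le_tyAt_iff {𝒳 : Set (Set ι)} (h𝒳 : IsUpperSet 𝒳) (e : ι) (w : Set ι) : 1 ≤ tyAt 𝒳 e w ↔ insert e w ∈ 𝒳 := by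
  unfold tyAt
  split_ifs with h1 h2
  · refine ⟨fun _ => h𝒳 ?_ h1, fun _ => by decide⟩
    exact Set.sdiff_subset.trans (Set.subset_insert e w)
  · exact ⟨fun _ => h2, fun _ => by decide⟩
  · exact ⟨fun h => absurd h (by decide), fun h => absurd h h2⟩

/-- The type only depends on `w` off `e`. [this work] -/
theorem tyAt_congr (𝒳 : Set (Set ι)) {e : ι} {w w' : Set ι} (h : w \ {e} = w' \ {e}) : tyAt 𝒳 e w = tyAt 𝒳 e w' := by
  have h2 : insert e w = insert e w' := by
    rw [← Set.insert_sdiff_singleton, h, Set.insert_sdiff_singleton]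
  unfold tyAt
  rw [h, h2]

/-- The type triple only depends on `w` off `e`. [this work] -/
theorem typ_congr (𝒰 𝒱 𝒲 : Set (Set ι)) {e : ι} {w w' : Set ι} (h : w \ {e} = w' \ {e}) :
    typ 𝒰 𝒱 𝒲 e w = typ 𝒰 𝒱 𝒲 e w' := by
  unfold typ
  rw [tyAt_congr 𝒰 h, tyAt_congr 𝒱 h, tyAt_congr 𝒲 h]

/-- `(insert e S ∆ τ) ∖ e = (S ∆ τ) ∖ e`. [folklore] -/
theorem insert_symmDiff_diff (e : ι) (S τ : Set ι) : (insert e S ∆ τ) \ {e} = (S ∆ τ) \ {e} := by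
  ext x
  simp only [Set.mem_sdiff, Set.mem_symmDiff, Set.mem_insert_iff, Set.mem_singleton_iff]
  by_cases hx : x = e
  · subst hx; tauto
  · tauto

/-- `((S ∖ e) ∆ τ) ∖ e = (S ∆ τ) ∖ e`. [folklore] -/
theorem sdiff_symmDiff_diff (e : ι) (S τ : Set ι) : ((S \ {e}) ∆ τ) \ {e} = (S ∆ τ) \ {e} := by
  ext x
  simp only [Set.mem_sdiff, Set.mem_symmDiff, Set.mem_singleton_iff]
  by_cases hx : x = e
  · subst hx; tauto
  · tauto

/-- The type triple of the copy is unchanged when `e` is inserted into the part. [this work] -/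
theorem typ_insert_symmDiff (𝒰 𝒱 𝒲 : Set (Set ι)) (e : ι) (S τ : Set ι) :
    typ 𝒰 𝒱 𝒲 e (insert e S ∆ τ) = typ 𝒰 𝒱 𝒲 e (S ∆ τ) :=
  typ_congr 𝒰 𝒱 𝒲 (insert_symmDiff_diff e S τ)

/-- The type triple of the copy is unchanged when `e` is deleted from the part. [this work] -/
theorem typ_sdiff_symmDiff (𝒰 𝒱 𝒲 : Set (Set ι)) (e : ι) (S τ : Set ι) :
    typ 𝒰 𝒱 𝒲 e ((S \ {e}) ∆ τ) = typ 𝒰 𝒱 𝒲 e (S ∆ τ) :=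
  typ_congr 𝒰 𝒱 𝒲 (sdiff_symmDiff_diff e S τ)

/-- Reading membership from (bit, level): a copy containing `e` is in the up-set iff its level is `≥ 1`, a copy avoiding `e`
iff its level is `2`. [this work] -/
def rd (b : Bool) (x : Fin 3) : Bool := match b with
  | true => decide (1 ≤ x)
  | false => decide (x = 2)

/-- **Membership is read from the type**: for an up-set `𝒳` and `b = [e ∈ x]`, `x ∈ 𝒳 ↔ rd b (tyAt 𝒳 e x)`. [this work] -/
theorem mem_iff_rd {𝒳 : Set (Set ι)} (h𝒳 : IsUpperSet 𝒳) (e : ι) (x : Set ι) (b : Bool) (hb : e ∈ x ↔ b = true) :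
    x ∈ 𝒳 ↔ rd b (tyAt 𝒳 e x) = true := by
  cases b
  · have he : e ∉ x := fun h => Bool.false_ne_true (hb.1 h)
    have hx : x \ {e} = x := by
      ext y; simp only [Set.mem_sdiff, Set.mem_singleton_iff, and_iff_left_iff_imp]
      rintro hy rfl; exact he hy
    simp only [rd, decide_eq_true_eq, tyAt_eq_two_iff, hx]
  · have he : e ∈ x := hb.2 rfl
    simp only [rd, decide_eq_true_eq, one_le_tyAt_iff h𝒳, Set.insert_eq_of_mem he]

/-- The type is monotone in the set (for an up-set). [this work] -/
theorem tyAt_mono {𝒳 : Set (Set ι)} (h𝒳 : IsUpperSet 𝒳) (e : ι) {w w' : Set ι} (h : w ⊆ w') : tyAt 𝒳 e w ≤ tyAt 𝒳 e w' := by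
  have hd : w \ {e} ⊆ w' \ {e} := Set.sdiff_subset_sdiff_left h
  have hi : insert e w ⊆ insert e w' := Set.insert_subset_insert h
  unfold tyAt
  split_ifs with h1 h2 h3 h4 h5 <;> first | decide | exact absurd (h𝒳 hd h1) ‹_› | exact absurd (h𝒳 hi ‹_›) ‹_›

/-- Componentwise comparison of type triples ("principal type-up-sets" are `{t | th ≤ t}`). [this work] -/
def ge3 (t th : Ty) : Bool := decide (th.1 ≤ t.1) && (decide (th.2.1 ≤ t.2.1) && decide (th.2.2 ≤ t.2.2))

/-- The type-threshold family `{w | th ≤ typ w}` is an up-set when `𝒰, 𝒱, 𝒲` are. [this work] -/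
theorem isUpperSet_ge3 {𝒰 𝒱 𝒲 : Set (Set ι)} (h𝒰 : IsUpperSet 𝒰) (h𝒱 : IsUpperSet 𝒱) (h𝒲 : IsUpperSet 𝒲)
    (e : ι) (th : Ty) : IsUpperSet {w : Set ι | ge3 (typ 𝒰 𝒱 𝒲 e w) th = true} := by
  intro w w' hww' hw
  simp only [Set.mem_setOf_eq, ge3, typ, Bool.and_eq_true, decide_eq_true_eq] at hw ⊢
  exact ⟨hw.1.trans (tyAt_mono h𝒰 e hww'), hw.2.1.trans (tyAt_mono h𝒱 e hww'), hw.2.2.trans (tyAt_mono h𝒲 e hww')⟩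


/-! ## The pinned typed sum -/

section Pinned

variable [Fintype ι]

/-- Ordered 3-partitions `(S₁, S₂, (S₁ ∪ S₂)ᶜ)` with `e` in the SECOND part. [this work] -/
def pinned (e : ι) : Finset (Set ι × Set ι) := Finset.univ.filter fun q => Disjoint q.1 q.2 ∧ e ∈ q.2

variable (𝒰 𝒱 𝒲 : Set (Set ι)) (e : ι) (τ : Set ι)

/-- The PINNED TYPED SUM: `Σ f (typ a) (typ b) (typ c)` over ordered 3-partitions with `e` in the second part, copies
`a = S₁ ∆ τ`, `b = S₂ ∆ τ`, `c = S₃ ∆ τ`. [this work] -/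
def tsumP (f : Ty → Ty → Ty → ℤ) : ℤ :=
  ∑ q ∈ pinned e, f (typ 𝒰 𝒱 𝒲 e (q.1 ∆ τ)) (typ 𝒰 𝒱 𝒲 e (q.2 ∆ τ)) (typ 𝒰 𝒱 𝒲 e ((q.1 ∪ q.2)ᶜ ∆ τ))

/-- Additivity. [this work] -/
theorem tsumP_add (f g : Ty → Ty → Ty → ℤ) :
    tsumP 𝒰 𝒱 𝒲 e τ (fun a b c => f a b c + g a b c) = tsumP 𝒰 𝒱 𝒲 e τ f + tsumP 𝒰 𝒱 𝒲 e τ g := by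
  unfold tsumP; exact Finset.sum_add_distrib

/-- Subtractivity. [this work] -/
theorem tsumP_sub (f g : Ty → Ty → Ty → ℤ) :
    tsumP 𝒰 𝒱 𝒲 e τ (fun a b c => f a b c - g a b c) = tsumP 𝒰 𝒱 𝒲 e τ f - tsumP 𝒰 𝒱 𝒲 e τ g := by
  unfold tsumP; exact Finset.sum_sub_distrib _ _

/-- Homogeneity. [this work] -/
theorem tsumP_const_mul (m : ℤ) (f : Ty → Ty → Ty → ℤ) :
    tsumP 𝒰 𝒱 𝒲 e τ (fun a b c => m * f a b c) = m * tsumP 𝒰 𝒱 𝒲 e τ f := by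
  unfold tsumP; rw [Finset.mul_sum]

/-- Congruence. [this work] -/
theorem tsumP_congr {f g : Ty → Ty → Ty → ℤ} (h : ∀ a b c, f a b c = g a b c) :
    tsumP 𝒰 𝒱 𝒲 e τ f = tsumP 𝒰 𝒱 𝒲 e τ g := by
  unfold tsumP; exact Finset.sum_congr rfl fun q _ => h _ _ _

/-- Sum over a list of integrands. [this work] -/
theorem tsumP_listSum (L : List (Ty → Ty → Ty → ℤ)) :
    tsumP 𝒰 𝒱 𝒲 e τ (fun a b c => (L.map fun f => f a b c).sum) = (L.map fun f => tsumP 𝒰 𝒱 𝒲 e τ f).sum := by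
  induction L with
  | nil => simp [tsumP]
  | cons f L ih =>
    simp only [List.map_cons, List.sum_cons]
    rw [← ih, ← tsumP_add]

/-- Nonnegativity from the REALISED types: if `f ≥ 0` on all type triples of actual sets, then `tsumP f ≥ 0`. [this work] -/
theorem tsumP_nonneg_of_sets {f : Ty → Ty → Ty → ℤ}
    (h : ∀ wa wb wc : Set ι, 0 ≤ f (typ 𝒰 𝒱 𝒲 e wa) (typ 𝒰 𝒱 𝒲 e wb) (typ 𝒰 𝒱 𝒲 e wc)) :
    0 ≤ tsumP 𝒰 𝒱 𝒲 e τ f := by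
  unfold tsumP; exact Finset.sum_nonneg fun q _ => h _ _ _

/-- Swapping the two ACTIVE arguments (parts 1 and 3) does not change the pinned sum. [this work] -/
theorem tsumP_swap13 (f : Ty → Ty → Ty → ℤ) :
    tsumP 𝒰 𝒱 𝒲 e τ f = tsumP 𝒰 𝒱 𝒲 e τ (fun a b c => f c b a) := by
  unfold tsumP
  refine Finset.sum_nbij' (fun q => ((q.1 ∪ q.2)ᶜ, q.2)) (fun q => ((q.1 ∪ q.2)ᶜ, q.2)) ?_ ?_ ?_ ?_ ?_
  · intro q hq
    simp only [pinned, mem_filter, mem_univ, true_and] at hq ⊢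
    exact ⟨Set.disjoint_left.2 fun x hx hx2 => hx (Or.inr hx2), hq.2⟩
  · intro q hq
    simp only [pinned, mem_filter, mem_univ, true_and] at hq ⊢
    exact ⟨Set.disjoint_left.2 fun x hx hx2 => hx (Or.inr hx2), hq.2⟩
  · intro q hq
    simp only [pinned, mem_filter, mem_univ, true_and] at hq
    exact Prod.ext (compl_union_compl_union_eq hq.1) rfl
  · intro q hq
    simp only [pinned, mem_filter, mem_univ, true_and] at hq
    exact Prod.ext (compl_union_compl_union_eq hq.1) rfl
  · intro q hq
    simp only [pinned, mem_filter, mem_univ, true_and] at hq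
    simp only [compl_union_compl_union_eq hq.1]

/-- Swapping the SPECTATOR with an active argument (parts 1 and 2, moving `e` back into part 2) does not change the pinned sum:
the types ignore `e`. [this work] -/
theorem tsumP_swap12 (f : Ty → Ty → Ty → ℤ) :
    tsumP 𝒰 𝒱 𝒲 e τ f = tsumP 𝒰 𝒱 𝒲 e τ (fun a b c => f b a c) := by
  unfold tsumP
  refine Finset.sum_nbij' (fun q => (q.2 \ {e}, insert e q.1)) (fun q => (q.2 \ {e}, insert e q.1)) ?_ ?_ ?_ ?_ ?_
  · intro q hq
    simp only [pinned, mem_filter, mem_univ, true_and] at hq ⊢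
    refine ⟨Set.disjoint_insert_right.2 ⟨fun h => h.2 rfl, ?_⟩, Set.mem_insert e _⟩
    exact Disjoint.mono_left Set.sdiff_subset hq.1.symm
  · intro q hq
    simp only [pinned, mem_filter, mem_univ, true_and] at hq ⊢
    refine ⟨Set.disjoint_insert_right.2 ⟨fun h => h.2 rfl, ?_⟩, Set.mem_insert e _⟩
    exact Disjoint.mono_left Set.sdiff_subset hq.1.symm
  · intro q hq
    simp only [pinned, mem_filter, mem_univ, true_and] at hq
    have he1 : e ∉ q.1 := fun h => Set.disjoint_left.1 hq.1 h hq.2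
    ext <;> simp [insert_sdiff_singleton_of_notMem he1, Set.insert_eq_of_mem hq.2]
  · intro q hq
    simp only [pinned, mem_filter, mem_univ, true_and] at hq
    have he1 : e ∉ q.1 := fun h => Set.disjoint_left.1 hq.1 h hq.2
    ext <;> simp [insert_sdiff_singleton_of_notMem he1, Set.insert_eq_of_mem hq.2]
  · intro q hq
    simp only [pinned, mem_filter, mem_univ, true_and] at hq
    have hu : q.2 \ {e} ∪ insert e q.1 = q.1 ∪ q.2 := by rw [diff_union_insert_eq hq.2, Set.union_comm]
    simp only [typ_insert_symmDiff, typ_sdiff_symmDiff, hu]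

/-- Six-fold symmetrisation of an integrand. [this work] -/
def sym6 (f : Ty → Ty → Ty → ℤ) : Ty → Ty → Ty → ℤ :=
  fun a b c => f a b c + f b a c + f c b a + f a c b + f b c a + f c a b

/-- `6 · tsumP f = tsumP (sym6 f)`. [this work] -/
theorem six_mul_tsumP (f : Ty → Ty → Ty → ℤ) : 6 * tsumP 𝒰 𝒱 𝒲 e τ f = tsumP 𝒰 𝒱 𝒲 e τ (sym6 f) := by
  have e1 : tsumP 𝒰 𝒱 𝒲 e τ (fun a b c => f b a c) = tsumP 𝒰 𝒱 𝒲 e τ f := (tsumP_swap12 𝒰 𝒱 𝒲 e τ f).symm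
  have e2 : tsumP 𝒰 𝒱 𝒲 e τ (fun a b c => f c b a) = tsumP 𝒰 𝒱 𝒲 e τ f := (tsumP_swap13 𝒰 𝒱 𝒲 e τ f).symm
  have e3 : tsumP 𝒰 𝒱 𝒲 e τ (fun a b c => f b c a) = tsumP 𝒰 𝒱 𝒲 e τ f :=
    (tsumP_swap13 𝒰 𝒱 𝒲 e τ (fun a b c => f b a c)).symm.trans e1
  have e4 : tsumP 𝒰 𝒱 𝒲 e τ (fun a b c => f c a b) = tsumP 𝒰 𝒱 𝒲 e τ f :=
    (tsumP_swap12 𝒰 𝒱 𝒲 e τ (fun a b c => f c b a)).symm.trans e2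
  have e5 : tsumP 𝒰 𝒱 𝒲 e τ (fun a b c => f a c b) = tsumP 𝒰 𝒱 𝒲 e τ f :=
    (tsumP_swap12 𝒰 𝒱 𝒲 e τ (fun a b c => f b c a)).symm.trans e3
  show 6 * tsumP 𝒰 𝒱 𝒲 e τ f = tsumP 𝒰 𝒱 𝒲 e τ
    (fun a b c => f a b c + f b a c + f c b a + f a c b + f b c a + f c a b)
  rw [tsumP_add, tsumP_add, tsumP_add, tsumP_add, tsumP_add, e1, e2, e3, e4, e5]
  ring

/-- Nonnegativity from a CLASS of types: if every realised type satisfies `cls` and the six-fold symmetrisation of `f` is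
nonnegative on class triples, then `tsumP f ≥ 0`. [this work] -/
theorem tsumP_nonneg_of_sym6 (cls : Ty → Bool) (hcls : ∀ w : Set ι, cls (typ 𝒰 𝒱 𝒲 e w) = true) {f : Ty → Ty → Ty → ℤ}
    (h : ∀ ta tb tc : Ty, cls ta = true → cls tb = true → cls tc = true → 0 ≤ sym6 f ta tb tc) :
    0 ≤ tsumP 𝒰 𝒱 𝒲 e τ f := by
  have h6 : 0 ≤ tsumP 𝒰 𝒱 𝒲 e τ (sym6 f) :=
    tsumP_nonneg_of_sets 𝒰 𝒱 𝒲 e τ fun wa wb wc => h _ _ _ (hcls wa) (hcls wb) (hcls wc)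
  rw [← six_mul_tsumP] at h6
  omega

/-- Boolean to integer. [folklore] -/
def bz (b : Bool) : ℤ := cond b 1 0

/-- A PINNED COUNT with a predicate on the three types is the pinned sum of its indicator. [this work] -/
theorem tri_pin_eq_tsumP (Q : Ty → Ty → Ty → Bool) :
    ((tri fun S₁ S₂ S₃ => e ∈ S₂ ∧ Q (typ 𝒰 𝒱 𝒲 e (S₁ ∆ τ)) (typ 𝒰 𝒱 𝒲 e (S₂ ∆ τ)) (typ 𝒰 𝒱 𝒲 e (S₃ ∆ τ)) = true : ℕ) : ℤ)
      = tsumP 𝒰 𝒱 𝒲 e τ (fun a b c => bz (Q a b c)) := by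
  unfold tri tsumP pinned
  dsimp only
  rw [Finset.card_filter, Finset.sum_filter]
  push_cast
  refine Finset.sum_congr rfl fun q _ => ?_
  by_cases hD : Disjoint q.1 q.2
  · by_cases hE : e ∈ q.2
    · simp [hD, hE, bz]
    · simp [hE]
  · simp [hD]

end Pinned

end TypedSlice

end Summit.CriticalPhenomena.PercolationContinuityZ3.Theorems.ThreePartition
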